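import Literature.Geometry.Riemannian.OneFormKatoInequality
import Mathlib.Analysis.SpecialFunctions.Sqrt
import Mathlib.Analysis.SpecificLimits.Basic
import HarnessLib

/-!
# The Sobolev inequality on `1`-forms from `(S_p)` and Kato's inequality

Third layer of the proof programme of the named fact
`Literature.Geometry.Riemannian.Carron1999_finrank_l2HarmonicOneForms_le` (Carron 1999 = Carron's
habilitation memoir, Thm. 4.3, `k = 1`). The printed proof transports the Sobolev inequality
`(S_p)` on functions,

  `μ (∫_X |u|^{2p/(p-2)} dV_h)^{1-2/p} ≤ ∫_X |du|²_h dV_h   (u ∈ C^∞_c(X))`,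

to differential forms through Kato's inequality `|d|α|| ≤ |∇α|` (memoir §4.a, proof of Prop. 4.2:
"on utilise alors l'inégalité de Sobolev pour minorer le premier terme"; §4.b, proof of Thm. 4.3:
"grâce à l'inégalité de Sobolev et l'inégalité de Kato"). Since `|α|` is only Lipschitz, this is
done here with the smooth compactly supported regularisations `u_ε = (|α|² + ε²)^{1/2} - ε ↑ |α|`
(`ε ↓ 0`), whose differentials still satisfy `|du_ε|_h ≤ |∇α|_h`, and monotone convergence:

* `contMDiffAt_innerDual_oneForm` — `|α|² = h⁻¹(α, α)` is `C^∞` for a `C^∞` `1`-form;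
* `contMDiffAt_sqrt_innerDual_add_sq`, `innerDual_mvfderiv_sqrt_le_normSq` — `u_ε` is `C^∞` and
  `h⁻¹(du_ε, du_ε) ≤ |∇α|²_h = normSq (∇α)` (from `OneFormKatoInequality.kato_sq`);
* `hasSobolevInequality_oneForm` — **for every compactly supported `C^∞` `1`-form `α`,
  `μ (∫_X |α|^{2p/(p-2)} dV_h)^{1-2/p} ≤ ∫_X |∇α|²_h dV_h`** under `HasSobolevInequality h p μ`,
  `p > 2` (no completeness needed).

Everything is proved; no definitions, no named facts (D-0026).

## References

* G. Carron, *Formes harmoniques L² sur les variétés riemanniennes non-compactes*, mémoire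
  d'habilitation (1999) = Rend. Mat. Appl. (7) 21 (2001), §4.a, Prop. 4.2 and its proof; §4.b,
  Thm. 4.3 and its proof sketch (pp. 22–24 of the author's PDF). [`Carron1999HdR`]
* G. Carron, *L²-cohomologie et inégalités de Sobolev*, Math. Ann. 314 (1999) 613–639.
  [`Carron1999`]
-/

noncomputable section

open Bundle Set Function Filter FiberBundle
open scoped Manifold ContDiff Topology ENNReal

namespace Literature.Geometry.Riemannian

open _root_.MeasureTheory Literature.Geometry.Lorentzian

variable {E : Type*} [NormedAddCommGroup E] [NormedSpace ℝ E] {H : Type*} [TopologicalSpace H]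
  {I : ModelWithCorners ℝ E H} {X : Type*} [TopologicalSpace X] [ChartedSpace H X]
  [IsManifold I ∞ X] [FiniteDimensional ℝ E] {x : X}

/-- `y ↦ g⁻¹(α, β)` is `C^∞` at `x` for `1`-forms `α, β` that are `C^∞` at `x` (it is `α(♯β)`
with `♯β` a smooth vector field, `contMDiffAt_sharp_oneForm`). [folklore] -/
theorem contMDiffAt_innerDual_oneForm (g : PseudoRiemannianMetric I ∞ E (TangentSpace I : X → Type _))
    {α β : Π x : X, TangentSpace I x →L[ℝ] ℝ}
    (hα : ContMDiffAt I (I.prod 𝓘(ℝ, E →L[ℝ] ℝ)) ∞ (oneFormSection α) x)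
    (hβ : ContMDiffAt I (I.prod 𝓘(ℝ, E →L[ℝ] ℝ)) ∞ (oneFormSection β) x) :
    ContMDiffAt I 𝓘(ℝ, ℝ) ∞ (fun y ↦ g.innerDual y (α y).toLinearMap (β y).toLinearMap) x := by
  have hS := contMDiffAt_sharp_oneForm g le_rfl hβ
  have : ContMDiffAt I (I.prod 𝓘(ℝ, ℝ)) ∞
      (fun p ↦ TotalSpace.mk' ℝ (E := Bundle.Trivial X ℝ) p
        (α p (g.sharp p (β p).toLinearMap))) x := by
    apply ContMDiffAt.clm_bundle_apply (F₁ := E)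
    · exact hα
    · exact hS
  simp only [contMDiffAt_totalSpace] at this
  exact this.2

section Regularisation

variable [CompleteSpace E] (h : ContMDiffRiemannianMetric I ∞ E (TangentSpace I : X → Type _))
  [(PseudoRiemannianMetric.ofRiemannian h).HasLeviCivita]

omit [CompleteSpace E] [(PseudoRiemannianMetric.ofRiemannian h).HasLeviCivita] in
/-- **The regularised norm `u_ε = (|α|² + ε²)^{1/2} - ε` of a smooth `1`-form is smooth** (for
`ε ≠ 0`; `√·` is smooth off `0`). [folklore] -/
theorem contMDiffAt_sqrt_innerDual_add_sq {ε : ℝ} (hε : ε ≠ 0)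
    {α : Π x : X, TangentSpace I x →L[ℝ] ℝ}
    (hα : ContMDiffAt I (I.prod 𝓘(ℝ, E →L[ℝ] ℝ)) ∞ (oneFormSection α) x) :
    ContMDiffAt I 𝓘(ℝ, ℝ) ∞ (fun y ↦ Real.sqrt ((PseudoRiemannianMetric.ofRiemannian h).innerDual y
      (α y).toLinearMap (α y).toLinearMap + ε ^ 2) - ε) x := by
  have hN := contMDiffAt_innerDual_oneForm (PseudoRiemannianMetric.ofRiemannian h) hα hα
  have hpos : (PseudoRiemannianMetric.ofRiemannian h).innerDual x (α x).toLinearMap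
      (α x).toLinearMap + ε ^ 2 ≠ 0 :=
    (add_pos_of_nonneg_of_pos (innerDual_self_nonneg (h := h) x _) (by positivity)).ne'
  have hsqrt : ContMDiffAt 𝓘(ℝ, ℝ) 𝓘(ℝ, ℝ) ∞ Real.sqrt
      ((PseudoRiemannianMetric.ofRiemannian h).innerDual x (α x).toLinearMap
        (α x).toLinearMap + ε ^ 2) := (Real.contDiffAt_sqrt hpos).contMDiffAt
  exact (hsqrt.comp x (hN.add contMDiffAt_const)).sub contMDiffAt_const

/-- **Kato for the regularised norm**: `|d u_ε|²_h ≤ |∇α|²_h` pointwise, where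
`u_ε = (|α|² + ε²)^{1/2} - ε`, `ε ≠ 0` (`d u_ε = d|α|² / (2(|α|² + ε²)^{1/2})` and
`|d|α|²|² ≤ 4|α|²|∇α|²`, `kato_sq`). Carron 1999HdR, §4.a (Kato's inequality).
[cite: Carron1999HdR, §4.a, Prop. 4.2 (proof)] -/
theorem innerDual_mvfderiv_sqrt_le_normSq {ε : ℝ} (hε : ε ≠ 0)
    {α : Π x : X, TangentSpace I x →L[ℝ] ℝ}
    (hα : ContMDiffAt I (I.prod 𝓘(ℝ, E →L[ℝ] ℝ)) ∞ (oneFormSection α) x) :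
    (PseudoRiemannianMetric.ofRiemannian h).innerDual x
      (mvfderiv I (fun y ↦ Real.sqrt ((PseudoRiemannianMetric.ofRiemannian h).innerDual y
        (α y).toLinearMap (α y).toLinearMap + ε ^ 2) - ε) x).toLinearMap
      (mvfderiv I (fun y ↦ Real.sqrt ((PseudoRiemannianMetric.ofRiemannian h).innerDual y
        (α y).toLinearMap (α y).toLinearMap + ε ^ 2) - ε) x).toLinearMap ≤
      (PseudoRiemannianMetric.ofRiemannian h).normSq x
        ((PseudoRiemannianMetric.ofRiemannian h).covDerivOneForm α x) := by
  have hkato := kato_sq h le_rfl (by exact_mod_cast le_top) hα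
  have hnn : ∀ y, 0 ≤ (PseudoRiemannianMetric.ofRiemannian h).innerDual y (α y).toLinearMap
      (α y).toLinearMap := fun y ↦ innerDual_self_nonneg (h := h) y _
  have hNs := contMDiffAt_innerDual_oneForm (PseudoRiemannianMetric.ofRiemannian h) hα hα
  have hQ : 0 ≤ (PseudoRiemannianMetric.ofRiemannian h).normSq x
      ((PseudoRiemannianMetric.ofRiemannian h).covDerivOneForm α x) :=
    (PseudoRiemannianMetric.ofRiemannian h).normSq_nonneg x
      (PseudoRiemannianMetric.isRiemannian_ofRiemannian h) _
  set G := PseudoRiemannianMetric.ofRiemannian h with hG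
  set Nf : X → ℝ := fun y ↦ G.innerDual y (α y).toLinearMap (α y).toLinearMap with hNf
  set s : X → ℝ := fun y ↦ Real.sqrt (Nf y + ε ^ 2) with hs_def
  have hspos : ∀ y, 0 < s y := fun y ↦
    Real.sqrt_pos.2 (add_pos_of_nonneg_of_pos (hnn y) (by positivity))
  have hNd : MDifferentiableAt I 𝓘(ℝ, ℝ) Nf x := hNs.mdifferentiableAt (by simp)
  have hsd : MDifferentiableAt I 𝓘(ℝ, ℝ) s x := by
    have hsqrt : MDifferentiableAt 𝓘(ℝ, ℝ) 𝓘(ℝ, ℝ) Real.sqrt (Nf x + ε ^ 2) :=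
      (Real.hasDerivAt_sqrt
        (add_pos_of_nonneg_of_pos (hnn x) (by positivity)).ne').differentiableAt.mdifferentiableAt
    exact hsqrt.comp x (hNd.add mdifferentiableAt_const)
  -- `s² = N + ε²`, so `2 s ds = dN`
  have hss : s * s = fun y ↦ Nf y + ε ^ 2 := funext fun y ↦
    Real.mul_self_sqrt (add_nonneg (hnn y) (sq_nonneg ε))
  have hd1 : mvfderiv I (s * s) x = (2 * s x) • mvfderiv I s x := by
    rw [mvfderiv_mul hsd hsd, two_mul, add_smul]
  have hd2 : mvfderiv I (s * s) x = mvfderiv I Nf x := by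
    rw [hss]
    have : (fun y ↦ Nf y + ε ^ 2) = Nf + fun _ ↦ ε ^ 2 := by funext y; simp
    rw [this, mvfderiv_add hNd mdifferentiableAt_const, mvfderiv_const, add_zero]
  have hds : mvfderiv I s x = (1 / (2 * s x)) • mvfderiv I Nf x := by
    rw [← hd2, hd1, smul_smul]
    have hsx := (hspos x).ne'
    field_simp
    simp
  -- `d u_ε = ds`
  have hdu : mvfderiv I (fun y ↦ s y - ε) x = mvfderiv I s x := by
    have : (fun y ↦ s y - ε) = s - fun _ ↦ ε := by funext y; simp
    rw [this, mvfderiv_sub hsd mdifferentiableAt_const, mvfderiv_const, sub_zero]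
  show G.innerDual x (mvfderiv I (fun y ↦ s y - ε) x).toLinearMap
    (mvfderiv I (fun y ↦ s y - ε) x).toLinearMap ≤ G.normSq x (G.covDerivOneForm α x)
  rw [hdu, hds]
  have hscale : ∀ (c : ℝ) (D : TangentSpace I x →L[ℝ] ℝ),
      G.innerDual x (c • D).toLinearMap (c • D).toLinearMap =
        c ^ 2 * G.innerDual x D.toLinearMap D.toLinearMap := by
    intro c D
    simp only [PseudoRiemannianMetric.innerDual, ContinuousLinearMap.toLinearMap_smul, map_smul,
      LinearMap.smul_apply, smul_eq_mul]
    ring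
  rw [hscale]
  have hsx2 : s x ^ 2 = Nf x + ε ^ 2 := Real.sq_sqrt (add_nonneg (hnn x) (sq_nonneg ε))
  have hNx := hnn x
  have hsx : 0 < s x := hspos x
  calc (1 / (2 * s x)) ^ 2 * G.innerDual x (mvfderiv I Nf x).toLinearMap (mvfderiv I Nf x).toLinearMap
      ≤ (1 / (2 * s x)) ^ 2 * (4 * Nf x * G.normSq x (G.covDerivOneForm α x)) :=
        mul_le_mul_of_nonneg_left hkato (sq_nonneg _)
    _ = (Nf x / (Nf x + ε ^ 2)) * G.normSq x (G.covDerivOneForm α x) := by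
        rw [← hsx2]; field_simp; ring
    _ ≤ 1 * G.normSq x (G.covDerivOneForm α x) := by
        gcongr
        rw [div_le_one (by positivity)]
        nlinarith [sq_nonneg ε]
    _ = G.normSq x (G.covDerivOneForm α x) := one_mul _

end Regularisation


section Sobolev

variable [CompleteSpace E] [T3Space X] [MeasurableSpace X] [BorelSpace X]
  (h : ContMDiffRiemannianMetric I ∞ E (TangentSpace I : X → Type _))
  [(PseudoRiemannianMetric.ofRiemannian h).HasLeviCivita]

/-- **The Sobolev inequality on `1`-forms, from `(S_p)` and Kato's inequality.** If `(X, h)`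
satisfies the Sobolev inequality `(S_p)` with constant `μ`,
`μ (∫ |u|^{2p/(p-2)})^{1-2/p} ≤ ∫ |du|²` for `u ∈ C^∞_c(X)` (`HasSobolevInequality h p μ`,
`p > 2`), then for every compactly supported `C^∞` `1`-form `α`

  `μ (∫_X |α|^{2p/(p-2)} dV_h)^{1-2/p} ≤ ∫_X |∇α|²_h dV_h`,

`|α|² = h⁻¹(α, α)`, `|∇α|² = normSq (∇α)`. Proof as printed ("grâce à l'inégalité de Sobolev et
l'inégalité de Kato"): apply `(S_p)` to the smooth compactly supported regularisations
`u_ε = (|α|² + ε²)^{1/2} - ε`, whose differentials satisfy `|du_ε| ≤ |∇α|`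
(`innerDual_mvfderiv_sqrt_le_normSq`), and let `ε ↓ 0` (`u_ε ↑ |α|`, monotone convergence).
No completeness is needed. Carron 1999HdR, §4.a, proof of Prop. 4.2 and §4.b, proof of Thm. 4.3
(the Sobolev inequality transported to forms). [cite: Carron1999HdR, §4.a, Prop. 4.2 (proof)] -/
theorem hasSobolevInequality_oneForm {p μ : ℝ} (hp : 2 < p) (hS : HasSobolevInequality h p μ)
    {α : Π x : X, TangentSpace I x →L[ℝ] ℝ}
    (hα : ∀ x, ContMDiffAt I (I.prod 𝓘(ℝ, E →L[ℝ] ℝ)) ∞ (oneFormSection α) x)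
    {K : Set X} (hK : IsCompact K) (hαK : ∀ x ∉ K, α x = 0) :
    ENNReal.ofReal μ *
        (∫⁻ x, ENNReal.ofReal (((PseudoRiemannianMetric.ofRiemannian h).innerDual x
          (α x).toLinearMap (α x).toLinearMap) ^ (p / (p - 2))) ∂(riemannianMeasure h)) ^
          (1 - 2 / p) ≤
      ∫⁻ x, ENNReal.ofReal ((PseudoRiemannianMetric.ofRiemannian h).normSq x
        ((PseudoRiemannianMetric.ofRiemannian h).covDerivOneForm α x)) ∂(riemannianMeasure h) := by
  set G := PseudoRiemannianMetric.ofRiemannian h with hG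
  set Nf : X → ℝ := fun y ↦ G.innerDual y (α y).toLinearMap (α y).toLinearMap with hNf
  have hnn : ∀ y, 0 ≤ Nf y := fun y ↦ innerDual_self_nonneg (h := h) y _
  have hp2 : 0 < p - 2 := by linarith
  have hp0 : 0 < p := by linarith
  have hr : 0 < 1 - 2 / p := by
    rw [sub_pos, div_lt_one hp0]; linarith
  set q : ℝ := 2 * p / (p - 2) with hq
  have hq0 : 0 < q := by positivity
  -- the regularisations `u n = (N + ε_n²)^{1/2} - ε_n`, `ε_n = 1/(n+1)`
  set ε : ℕ → ℝ := fun n ↦ 1 / ((n : ℝ) + 1) with hε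
  have hεpos : ∀ n, 0 < ε n := fun n ↦ by positivity
  set u : ℕ → X → ℝ := fun n y ↦ Real.sqrt (Nf y + ε n ^ 2) - ε n with hu
  have hu_smooth : ∀ n, ContMDiff I 𝓘(ℝ, ℝ) ∞ (u n) := fun n y ↦
    contMDiffAt_sqrt_innerDual_add_sq h (hεpos n).ne' (hα y)
  have hu_supp : ∀ n, HasCompactSupport (u n) := fun n ↦ by
    refine HasCompactSupport.intro hK fun y hy ↦ ?_
    have hN0 : Nf y = 0 := by simp [hNf, hαK y hy, PseudoRiemannianMetric.innerDual]
    simp [hu, hN0, Real.sqrt_sq (hεpos n).le]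
  -- rationalised form and elementary properties
  have hspos : ∀ n y, 0 < Real.sqrt (Nf y + ε n ^ 2) := fun n y ↦
    Real.sqrt_pos.2 (add_pos_of_nonneg_of_pos (hnn y) (pow_pos (hεpos n) 2))
  have hu_eq : ∀ n y, u n y = Nf y / (Real.sqrt (Nf y + ε n ^ 2) + ε n) := by
    intro n y
    have hden : 0 < Real.sqrt (Nf y + ε n ^ 2) + ε n := add_pos (hspos n y) (hεpos n)
    rw [eq_div_iff hden.ne', hu]
    have := Real.mul_self_sqrt (add_nonneg (hnn y) (sq_nonneg (ε n)))
    nlinarith [this]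
  have hu_nonneg : ∀ n y, 0 ≤ u n y := fun n y ↦ by
    rw [hu_eq]; exact div_nonneg (hnn y) (add_pos (hspos n y) (hεpos n)).le
  have hε_anti : Antitone ε := fun n m hnm ↦ by
    simp only [hε]
    exact one_div_le_one_div_of_le (by positivity) (by exact_mod_cast Nat.succ_le_succ hnm)
  have hu_mono : ∀ y, Monotone (fun n ↦ u n y) := by
    intro y n m hnm
    simp only [hu_eq]
    have hεnm : ε m ≤ ε n := hε_anti hnm
    refine div_le_div_of_nonneg_left (hnn y) (add_pos (hspos m y) (hεpos m)) ?_
    gcongr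
  -- pointwise limit `u n y → √(N y)`
  have hε_lim : Tendsto ε atTop (𝓝 0) := tendsto_one_div_add_atTop_nhds_zero_nat
  have hu_lim : ∀ y, Tendsto (fun n ↦ u n y) atTop (𝓝 (Real.sqrt (Nf y))) := by
    intro y
    have hc : Continuous (fun t : ℝ ↦ Real.sqrt (Nf y + t ^ 2) - t) := by fun_prop
    have := hc.tendsto 0
    simp only [zero_pow two_ne_zero, add_zero, sub_zero] at this
    exact this.comp hε_lim
  -- the integrands `F n = |u n|^q` and their supremum
  set F : ℕ → X → ℝ≥0∞ := fun n y ↦ ENNReal.ofReal (|u n y| ^ q) with hF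
  have hF_meas : ∀ n, Measurable (F n) := fun n ↦
    ENNReal.measurable_ofReal.comp (((hu_smooth n).continuous.abs.measurable).pow_const q)
  have hF_mono : Monotone F := by
    intro n m hnm y
    simp only [hF]
    refine ENNReal.ofReal_le_ofReal (Real.rpow_le_rpow (abs_nonneg _) ?_ hq0.le)
    rw [abs_of_nonneg (hu_nonneg n y), abs_of_nonneg (hu_nonneg m y)]
    exact hu_mono y hnm
  have hF_sup : ∀ y, (⨆ n, F n y) = ENNReal.ofReal (Nf y ^ (p / (p - 2))) := by
    intro y
    refine iSup_eq_of_tendsto (fun n m hnm ↦ hF_mono hnm y) ?_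
    have hlim : Tendsto (fun n ↦ |u n y| ^ q) atTop (𝓝 (Real.sqrt (Nf y) ^ q)) := by
      have h1 : Tendsto (fun n ↦ |u n y|) atTop (𝓝 (Real.sqrt (Nf y))) := by
        have := (hu_lim y).abs
        rwa [abs_of_nonneg (Real.sqrt_nonneg _)] at this
      exact h1.rpow_const (Or.inr hq0.le)
    have hpow : Real.sqrt (Nf y) ^ q = Nf y ^ (p / (p - 2)) := by
      rw [Real.sqrt_eq_rpow, ← Real.rpow_mul (hnn y)]
      congr 1
      rw [hq]; field_simp
    rw [← hpow]
    exact (ENNReal.continuous_ofReal.tendsto _).comp hlim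
  -- monotone convergence
  have hMCT : ∫⁻ y, ENNReal.ofReal (Nf y ^ (p / (p - 2))) ∂(riemannianMeasure h) =
      ⨆ n, ∫⁻ y, F n y ∂(riemannianMeasure h) := by
    rw [← lintegral_iSup hF_meas hF_mono]
    exact lintegral_congr fun y ↦ (hF_sup y).symm
  -- each regularisation obeys the bound
  have hbound : ∀ n, ENNReal.ofReal μ * (∫⁻ y, F n y ∂(riemannianMeasure h)) ^ (1 - 2 / p) ≤
      ∫⁻ y, ENNReal.ofReal (G.normSq y (G.covDerivOneForm α y)) ∂(riemannianMeasure h) := by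
    intro n
    refine (hS (u n) (hu_smooth n) (hu_supp n)).trans (lintegral_mono fun y ↦ ?_)
    exact ENNReal.ofReal_le_ofReal (innerDual_mvfderiv_sqrt_le_normSq h (hεpos n).ne' (hα y))
  -- pass to the supremum
  set f : ℝ≥0∞ → ℝ≥0∞ := fun t ↦ ENNReal.ofReal μ * t ^ (1 - 2 / p) with hf
  have hf_cont : Continuous f :=
    (ENNReal.continuous_const_mul ENNReal.ofReal_ne_top).comp ENNReal.continuous_rpow_const
  have hf_mono : Monotone f := fun a b hab ↦
    mul_le_mul' le_rfl (ENNReal.monotone_rpow_of_nonneg hr.le hab)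
  have hf_bot : f ⊥ = ⊥ := by
    simp [hf, ENNReal.zero_rpow_of_pos hr]
  show f (∫⁻ y, ENNReal.ofReal (Nf y ^ (p / (p - 2))) ∂(riemannianMeasure h)) ≤ _
  rw [hMCT, hf_mono.map_iSup_of_continuousAt hf_cont.continuousAt hf_bot]
  exact iSup_le hbound

end Sobolev

end Literature.Geometry.Riemannian

end
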